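import Summits.QuantumFields.Balaban3D.Proofs.AxialGauge

/-!
# `Summit.QuantumFields.Balaban3D.Proofs.AxialGaugeFix` — §4 of `…Proofs.AxialGauge` (split for the 400-line rule): GAUGE FIXING INSIDE THE FIBRE.
# For a gauge-invariant integrable density the radial-forest variables may be set to `1` inside the crossing-parametrised fibre integral (the
# tree-gauge theorem of the 4D cell at the fresh ends of seat p1's radial forest, never block centres, where `crossParam` is covariant), and
# `crossParam V (W[forest := 1]) = axGlue V W` = `1` on the forest, `V(c)` on the crossing bonds, `W` elsewhere; hence
# **`rnTransport_axialGauge_ae_eq : (Tρ)(V) = ∫ ρ(axGlue V W) dW` dV-a.e.** — [Balaban1985UV3] (10) p. 258 + the δ-functions of (13) p. 259 resolved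
# for the decimation average (seat p4, lane `pub-balaban3d`; F4 of HOME/drafts/p4/FIBRE49.md)

HONEST FRAMING (lane PLAN.md §0, binding): see `…Proofs.SectAFirstStep`.  [folklore] measure theory; nothing of the paper is asserted.
-/

noncomputable section

namespace Summit.QuantumFields.Balaban3D.Proofs.AxialGaugeFix

open _root_.MeasureTheory
open Literature.MathematicalPhysics.QuantumFieldTheory.Balaban1983to89
open Literature.MathematicalPhysics.QuantumFieldTheory.Balaban1983to89.AveragingRT
open Literature.MathematicalPhysics.QuantumFieldTheory.Balaban1983to89.T4TreeGaugeFixing (fixTo fixTo_apply_of_mem fixTo_apply_of_not_mem)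
open Summit.QuantumFields.Balaban3D.Carriers
open Summit.QuantumFields.Balaban3D.Proofs.AxialGauge

variable {P : Params} {j : ℕ} {G : Type*} [GaugeGroup G]

/-! ## §4 Gauge fixing inside the fibre: the radial forest set to `1` -/

section Gauge

open Literature.MathematicalPhysics.QuantumFieldTheory.Balaban1983to89.GaugeField (gaugeAct GaugeInvariant)
open Literature.MathematicalPhysics.QuantumFieldTheory.Balaban1983to89.T4AxialGaugeFixing (siteTransf siteTransf_of_ne)

/-- Gauge covariance of the tail transports: `tail(U^u) = u(x_{t₀+1}) · tail(U) · u(x_{t₀+1+n})⁻¹`. [folklore] -/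
theorem tailProd_gaugeAct (u : GaugeTransf P j G) (U : GaugeField P j G) (c : PBond P (j + 1)) :
    ∀ n, tailProd (gaugeAct u U) c n = u (lineSite c (mid P + 1)) * tailProd U c n * (u (lineSite c (mid P + 1 + n)))⁻¹
  | 0 => by simp [tailProd]
  | n + 1 => by
    show tailProd (gaugeAct u U) c n * gaugeAct u U (line c (mid P + 1 + n)) = _
    rw [tailProd_gaugeAct u U c n]
    simp only [tailProd, GaugeField.gaugeAct, line, PBond.tgt, lineSite_succ, show mid P + 1 + (n + 1) = mid P + 1 + n + 1 by ring]
    group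

/-- **Gauge covariance of the crossing parametrisation** under gauge transformations trivial at the block centres (standing range):
`Φ(V, W^u) = Φ(V, W)^u`. [folklore] -/
theorem crossParam_gaugeAct (hj : j + 1 ≤ P.m + P.K) (u : GaugeTransf P j G) (hu : ∀ y : Site P (j + 1), u (emb y) = 1)
    (V : GaugeField P (j + 1) G) (W : GaugeField P j G) :
    crossParam V (gaugeAct u W) = gaugeAct u (crossParam V W) := by
  funext b
  by_cases hb : ∃ c : PBond P (j + 1), crossBond c = b
  · obtain ⟨c, rfl⟩ := hb
    rw [crossParam_cross hj, pathProd_gaugeAct, tailProd_gaugeAct, hu]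
    have hL : mid P + 1 + mid P = P.L := by unfold mid; obtain ⟨k, hk⟩ := P.hL.1; omega
    rw [hL, lineSite_L hj, hu]
    show _ = u (lineSite c (mid P)) * crossParam V W (crossBond c) * (u ((lineSite c (mid P)).shift c.dir))⁻¹
    rw [crossParam_cross hj, ← lineSite_succ]
    group
  · have hb' : ∀ c, b ≠ crossBond c := fun c h => hb ⟨c, h.symm⟩
    rw [crossParam_of_not_cross _ _ hb']
    show _ = u b.src * crossParam V W b * (u b.tgt)⁻¹
    rw [crossParam_of_not_cross _ _ hb']
    rfl

variable [MeasurableSpace G] [HaarData G] [MeasurableMul₂ G] [MeasurableInv G]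

/-- The radial forest of ALL blocks. [folklore] -/
abbrev forest (P : Params) (j : ℕ) : Finset (PBond P j) := radialBonds (Finset.univ : Finset (Site P (j + 1)))

/-- **THE FOREST VARIABLES MAY BE SET TO `1` INSIDE THE FIBRE INTEGRAL** of a gauge-invariant density (the tree-gauge theorem of the 4D cell at the
fresh ends of seat p1's radial forest, which are never block centres — there the parametrisation is covariant). [folklore] -/
theorem integral_crossParam_eq_fixTo [DecidableEq (PBond P j)] (hj : j + 1 ≤ P.m + P.K) (ρ : Density P j G) (hρm : Measurable ρ)
    (hρinv : GaugeInvariant ρ) (V : GaugeField P (j + 1) G) :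
    ∫ W, ρ (crossParam V W) ∂(fieldMeasure P j G) = ∫ W, ρ (crossParam V (fixTo (forest P j) 1 W)) ∂(fieldMeasure P j G) := by
  have hF : Measurable fun W : GaugeField P j G => ρ (crossParam V W) :=
    hρm.comp ((measurable_crossParam hj).comp (measurable_const.prodMk measurable_id))
  refine integral_eq_integral_fixTo_of_treeOrder (treeOrder_radialBonds hj Finset.univ) hF (fun b hb g W => ?_) 1
  show ρ (crossParam V (gaugeAct (siteTransf (radialFresh b) g) W)) = ρ (crossParam V W)
  rw [crossParam_gaugeAct hj _ (fun y => siteTransf_of_ne (emb_ne_radialFresh hj hb y) g), hρinv]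

/-- **THE GAUGE-FIXED FIBRE CONFIGURATION** `axGlue V W := Φ(V, W[forest := 1])`: `1` on the radial forest, `V(c)` on the crossing bond of the
line of `c`, `W(b)` on every other bond (`axGlue_of_mem_forest`, `axGlue_cross`, `axGlue_free`). [folklore] -/
def axGlue [DecidableEq (PBond P j)] (V : GaugeField P (j + 1) G) (W : GaugeField P j G) : GaugeField P j G :=
  crossParam V (fixTo (forest P j) 1 W)

omit [MeasurableSpace G] [HaarData G] [MeasurableMul₂ G] [MeasurableInv G] in
/-- On the forest, `axGlue V W = 1`. [folklore] -/
theorem axGlue_of_mem_forest [DecidableEq (PBond P j)] (hj : j + 1 ≤ P.m + P.K) (V : GaugeField P (j + 1) G) (W : GaugeField P j G)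
    {b : PBond P j} (hb : b ∈ forest P j) : axGlue V W b = 1 := by
  unfold axGlue
  rw [crossParam_of_not_cross _ _ (fun c h => crossBond_not_mem_radialBonds hj Finset.univ c (h ▸ hb)), fixTo_apply_of_mem hb]
  rfl

omit [MeasurableSpace G] [HaarData G] [MeasurableMul₂ G] [MeasurableInv G] in
/-- The head transport of a forest-fixed field is `1`. [folklore] -/
theorem pathProd_fixTo_forest [DecidableEq (PBond P j)] (hj : j + 1 ≤ P.m + P.K) (W : GaugeField P j G) (c : PBond P (j + 1)) :
    ∀ n, n ≤ mid P → pathProd (fixTo (forest P j) 1 W) c n = 1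
  | 0, _ => rfl
  | n + 1, hn => by
    have hL := P.hL.2
    show pathProd (fixTo (forest P j) 1 W) c n * fixTo (forest P j) 1 W (line c n) = 1
    rw [pathProd_fixTo_forest hj W c n (by omega),
      fixTo_apply_of_mem (line_mem_radialBonds hj c (by unfold mid at hn; omega) (by omega))]
    exact one_mul 1

omit [MeasurableSpace G] [HaarData G] [MeasurableMul₂ G] [MeasurableInv G] in
/-- The tail transport of a forest-fixed field is `1`. [folklore] -/
theorem tailProd_fixTo_forest [DecidableEq (PBond P j)] (hj : j + 1 ≤ P.m + P.K) (W : GaugeField P j G) (c : PBond P (j + 1)) :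
    ∀ n, n ≤ mid P → tailProd (fixTo (forest P j) 1 W) c n = 1
  | 0, _ => rfl
  | n + 1, hn => by
    have hL : mid P + 1 + mid P = P.L := by unfold mid; obtain ⟨k, hk⟩ := P.hL.1; omega
    show tailProd (fixTo (forest P j) 1 W) c n * fixTo (forest P j) 1 W (line c (mid P + 1 + n)) = 1
    rw [tailProd_fixTo_forest hj W c n (by omega), fixTo_apply_of_mem (line_mem_radialBonds hj c (by omega) (by omega))]
    exact one_mul 1

omit [MeasurableSpace G] [HaarData G] [MeasurableMul₂ G] [MeasurableInv G] in
/-- On the crossing bond of the line of `c`, `axGlue V W = V(c)` — «δ(ŪV^{−1})» resolved. [folklore] -/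
theorem axGlue_cross [DecidableEq (PBond P j)] (hj : j + 1 ≤ P.m + P.K) (V : GaugeField P (j + 1) G) (W : GaugeField P j G)
    (c : PBond P (j + 1)) : axGlue V W (crossBond c) = V c := by
  unfold axGlue
  rw [crossParam_cross hj, pathProd_fixTo_forest hj W c _ le_rfl, tailProd_fixTo_forest hj W c _ le_rfl]
  group

omit [MeasurableSpace G] [HaarData G] [MeasurableMul₂ G] [MeasurableInv G] in
/-- Off the forest and off the crossing bonds, `axGlue V W = W` (the free fluctuation variables — print's `|Ω₁*|` bonds at `Ω₁ = T`). [folklore] -/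
theorem axGlue_free [DecidableEq (PBond P j)] (V : GaugeField P (j + 1) G) (W : GaugeField P j G) {b : PBond P j}
    (hT : b ∉ forest P j) (hX : ∀ c, b ≠ crossBond c) : axGlue V W b = W b := by
  unfold axGlue
  rw [crossParam_of_not_cross _ _ hX, fixTo_apply_of_not_mem hT]

omit [MeasurableSpace G] [HaarData G] [MeasurableMul₂ G] [MeasurableInv G] in
/-- `axGlue V W` lies in the fibre of `V`. [folklore] -/
theorem axialAvg_axGlue [DecidableEq (PBond P j)] (hj : j + 1 ≤ P.m + P.K) (V : GaugeField P (j + 1) G) (W : GaugeField P j G) :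
    axialAvg (axGlue V W) = V := axialAvg_crossParam hj V _

/-- **THE GAUGE-FIXED FIBRE FORMULA OF THE LANE'S RENORMALIZATION TRANSFORM** ([Balaban1985UV3] (10) p. 258 + the δ-functions of (13) p. 259,
resolved for the decimation average): for a measurable, integrable, GAUGE-INVARIANT density `ρ` on the fine fields and the axial average in the
standing range, `(Tρ)(V) = ∫ ρ(axGlue V W) dW` for dV-a.e. `V` — the integrand is `ρ` at the configuration equal to `1` on the radial forest of every
block, to `V(c)` on the crossing bond of every line, and to the Haar variable `W(b)` on the remaining `|T*| = #bonds − #coarse bonds − #forest` bonds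
(the forest and crossing coordinates of `W` are dummy). [cite: Balaban1985UV3, (10) p.258 + (13) p.259] -/
theorem rnTransport_axialGauge_ae_eq [DecidableEq (PBond P j)] (hj : j + 1 ≤ P.m + P.K) (ρ : Density P j G)
    (hρi : Integrable ρ (fieldMeasure P j G)) (hρm : Measurable ρ) (hρinv : GaugeInvariant ρ) :
    rnTransport (axialAvg : GaugeField P j G → GaugeField P (j + 1) G) ρ
      =ᵐ[fieldMeasure P (j + 1) G] fun V => ∫ W, ρ (axGlue V W) ∂(fieldMeasure P j G) :=
  (rnTransport_cross_ae_eq hj ρ hρi).trans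
    (Filter.Eventually.of_forall fun V => integral_crossParam_eq_fixTo hj ρ hρm hρinv V)

end Gauge

end Summit.QuantumFields.Balaban3D.Proofs.AxialGaugeFix

end
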